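import Summits.AtomisticToContinuum.HydrodynamicLimit.Theses.AntiMazurCoboundaries
import Literature.MathematicalPhysics.KineticTheory.HardSphereEulerProofs
import Literature.MathematicalPhysics.KineticTheory.HardBallErgodicity
import Literature.Probability.Divergences.FDivVariational
import Summits.AtomisticToContinuum.HydrodynamicLimit.Theorems.CorrectorPressureDecay.Negative.MazurFloor

/-!
# Line `almost-invariant-duality` — COSTUME CERTIFICATE (lead c1, crux stmt-AtomisticToContinuum-14135)

Kernel-checked half of the triage/disproof verdict on the unpicked line `Lines/almost-invariant-duality.lean`
(triage r1-2: costume; `Disproof.lean` §(d): "stub 4 ⇔ X, no independent attack surface"):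

  `statewiseDuality_of_correctorPressureDecay : CorrectorPressureDecay → StatewiseDuality`
  `almostInvariantRigidity_of_correctorPressureDecay : CorrectorPressureDecay → AlmostInvariantRigidity`

by WEAK DUALITY only: the crux's witness `(lag, W)` serves every state `ρ` at once, because for a bounded measurable
`G` and a bounded probability density `ρ` the Gibbs inequality `∫ G ρ dμ − ∫ ρ log ρ dμ ≤ log ∫ e^G dμ` holds
(`integral_mul_sub_entropy_le_log_integral_exp`, pointwise Fenchel–Young `x·y ≤ x log x − x + e^y`). Together with the
line's own sorry-free composition `correctorPressureDecay_of_parts : CorrectorMinimax → GibbsFlowInvariance →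
StatewiseDuality → X` (stubs 1–2 TRUE; stub 2 proved in `Disproof.lean` §(d)), the line's hardest stub
`stub_almostInvariantRigidity` is EQUIVALENT to the crux modulo true infrastructure: driving this line cannot move X.
The statements `GibbsFlowInvariance`, `AlmostInvariantRigidity`, `StatewiseDuality` and the frame abbreviations are
copied VERBATIM from the skeleton (which is not an importable module). Workfile, not a proposal; 0 sorry.
-/

noncomputable section

open MeasureTheory ProbabilityTheory Set Filter Topology
open scoped ENNReal

namespace Summit.AtomisticToContinuum.HydrodynamicLimit.Cruxes.CorrectorPressureDecay.AlmostInvariantDualityCostume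

open Literature.MathematicalPhysics.KineticTheory (T3 V3 hsDiameter localGibbsLaw)
open Literature.Analysis.FluidPDE (HardSphereFlow Config configMomentum configEnergy)
open Summit.AtomisticToContinuum.HydrodynamicLimit.Theses.AntiMazurCoboundaries (CorrectorPressureDecay)

/-! ## Frame and statements (verbatim from `Lines/almost-invariant-duality.lean`) -/

/-! ## Frame abbreviations (all reducible; the crux decl is matched by unfolding) -/

/-- Hard-sphere flows of `N + 1` spheres of reduced diameter `σ` on `𝕋³` (the crux's `Φ`). -/
abbrev Flow (σ : ℝ) (N : ℕ) : Type :=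
  HardSphereFlow (Literature.Analysis.FluidPDE.Torus.geometry (Fin 3)) (hsDiameter σ N) (N + 1)

/-- Phase space of `N + 1` spheres on `𝕋³`. -/
abbrev Phase (N : ℕ) : Type := Config (N + 1) (Fin 3) T3

/-- The flow-invariant global Gibbs law `G_N` of the crux (constant profiles `a, u₀, θ`). -/
abbrev gibbs (σ a θ : ℝ) (u₀ : V3) (N : ℕ) (Φ : Flow σ N) : Measure (Phase N) :=
  localGibbsLaw σ (fun _ => a) (fun _ => u₀) (fun _ => θ) N Φ

/-- The fast one-body observable `F(z) = Σᵢ φ(xᵢ) g((vᵢ − u₀)/√θ)` of the crux. -/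
abbrev fluxObs (θ : ℝ) (u₀ : V3) (φ : T3 → ℝ) (g : V3 → ℝ) (N : ℕ) (z : Phase N) : ℝ :=
  ∑ i, φ (z i).1 * g ((Real.sqrt θ)⁻¹ • ((z i).2 - u₀))

/-- Statement of `stub_gibbsFlowInvariance` — **the global Gibbs law is invariant under every hard-sphere flow**:
each time-`t` map `Φ.flow t` preserves `G_N = localGibbsLaw σ a u₀ θ N Φ` (constant profiles). This is the route's
support item `HomogeneousInvariance` (stmt-AtomisticToContinuum-9621, `Φ.lawAt G_N t = G_N`) together with
`HardSphereFlow.measurable_flow`; it is what makes `T = Φ.flow lag` admissible in `CorrectorMinimax` and what makes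
entropy witnesses cost-free in entropy (`H(Φ_lag#Q | G_N) = H(Q | G_N)`). -/
def GibbsFlowInvariance : Prop :=
  ∀ (σ a θ : ℝ) (u₀ : V3), 0 < σ → 0 < a → 0 < θ → ∀ (N : ℕ) (Φ : Flow σ N) (t : ℝ),
    MeasurePreserving (Φ.flow t) (gibbs σ a θ u₀ N Φ) (gibbs σ a θ u₀ N Φ)

/-- Statement of `stub_almostInvariantRigidity` — **the open stub: almost-invariant rigidity, conditional on the
anchor, state by state.** Given the frame fact `GibbsFlowInvariance` (stub 2, which every witness construction uses:
`Φ_lag#G_N = G_N`), in the crux's frame (`τ₀(δ)`, `N₀`, then for `N ≥ N₀` and every flow a `lag > 0` and a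
sup-norm radius `M`): for every bounded probability density `ρ` and every thermodynamic profile `f(P,E)` of `ρ`
(testing characterisation) whose dual value is `≤ (δ/2)(N+1)` (what `ThermodynamicSliceFloor` supplies), there is a
witness `W` in the cost ball `{|W| ≤ M, ∫exp(4|W|/h₀) dG_N ≤ e^{δ(N+1)}}`, `h₀ = τ₀(N+1)^{-1/3}`, with pay-off
`2∫(F − lag⁻¹(W∘Φ_lag − W))ρ dG_N − ∫ρ log ρ dG_N ≤ δ(N+1)`. Equivalently (entropy chain rule
`H(ρ) = H(f(P,E)) + H_fib(ρ)`, `E_ρ F = E_f F + E_G[ρ(F − E[F|P,E])]`): the bias of the NON-thermodynamic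
fluctuation `F − E[F|P,E]` under `ρ` is paid by the conditional entropy of `ρ` given `(P,E)`, by `(δ/2)(N+1)`, and by
the Orlicz almost-invariance price `2E_ρ D_W` — "an almost `Φ_lag`-invariant low-entropy state is almost
thermodynamic as far as fast one-body fluxes are concerned". At most crux-strength (`StatewiseDuality` implies it
by dropping the hypothesis). Tools recorded on the line card: F-witness (Fejér combinations of `F∘Φ_s`: reduces any
state to its Cesàro-averaged bias — the hard slice, dual of shared 10967), J-witness (`W = ε(h₀/8)log(ρ∘Φ_{−lag}/ρ)`,
price `(εh₀/4lag)·J(ρG, Φ_lag#ρG)`; on product tilts = Boltzmann's entropy production `D(q)`, closed near equilibrium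
by the PROVED `hardSphereLinearizedOp_spectralGap_holds`), lag rigidity (`lag ≤ h₀√δ/s_g`), and for the exactly
invariant residue fibre ergodicity (`simanyi_hardBall_ergodic`, unproved named fact; time-`lag` map ergodic on a.e.
`(P,E)`-fibre for a.e. `lag` by Fubini — `lag` is chosen after `Φ`). -/
def AlmostInvariantRigidity : Prop :=
  GibbsFlowInvariance →
  ∀ (a θ : ℝ) (u₀ : V3), 0 < a → 0 < θ → ∃ σ₀ : ℝ, 0 < σ₀ ∧ ∀ σ : ℝ, 0 < σ → σ < σ₀ →
    ∃ κ : ℝ, 0 < κ ∧ ∀ (φ : T3 → ℝ) (g : V3 → ℝ), Continuous φ → Continuous g →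
      (∀ x, |φ x| ≤ 1) → (∀ v, |g v| ≤ κ) →
      (∀ (c₀ c₂ : ℝ) (b : V3),
        ∫ v, g v * (c₀ + inner ℝ b v + c₂ * ‖v‖ ^ 2) ∂(ProbabilityTheory.stdGaussian V3) = 0) →
      ∀ δ : ℝ, 0 < δ → ∃ τ₀ : ℝ, 0 < τ₀ ∧ ∃ N₀ : ℕ, ∀ N : ℕ, N₀ ≤ N → ∀ Φ : Flow σ N,
        ∃ lag : ℝ, 0 < lag ∧ ∃ M : ℝ, 0 ≤ M ∧
          ∀ ρ : Phase N → ℝ, Measurable ρ → (∀ z, 0 ≤ ρ z) → (∃ C : ℝ, ∀ z, ρ z ≤ C) →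
            ∫ z, ρ z ∂(gibbs σ a θ u₀ N Φ) = 1 →
            ∀ f : V3 → ℝ → ℝ, Measurable (fun p : V3 × ℝ => f p.1 p.2) → (∀ p e, 0 ≤ f p e) →
              (∃ C : ℝ, ∀ p e, f p e ≤ C) →
              (∀ B : V3 → ℝ → ℝ, Measurable (fun p : V3 × ℝ => B p.1 p.2) →
                (∃ C : ℝ, ∀ p e, |B p e| ≤ C) →
                ∫ z, B (configMomentum z) (configEnergy z) * ρ z ∂(gibbs σ a θ u₀ N Φ) =
                  ∫ z, B (configMomentum z) (configEnergy z) *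
                    f (configMomentum z) (configEnergy z) ∂(gibbs σ a θ u₀ N Φ)) →
              2 * ∫ z, fluxObs θ u₀ φ g N z * f (configMomentum z) (configEnergy z) ∂(gibbs σ a θ u₀ N Φ) -
                  ∫ z, f (configMomentum z) (configEnergy z) *
                    Real.log (f (configMomentum z) (configEnergy z)) ∂(gibbs σ a θ u₀ N Φ)
                ≤ δ / 2 * (N + 1) →
              ∃ W : Phase N → ℝ, Measurable W ∧ (∀ z, |W z| ≤ M) ∧
                ∫⁻ z, ENNReal.ofReal (Real.exp (4 * (τ₀ * ((N + 1 : ℕ) : ℝ) ^ (-(1 / 3 : ℝ)))⁻¹ * |W z|))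
                    ∂(gibbs σ a θ u₀ N Φ) ≤ ENNReal.ofReal (Real.exp (δ * (N + 1))) ∧
                2 * ∫ z, (fluxObs θ u₀ φ g N z - lag⁻¹ * (W (Φ.flow lag z) - W z)) * ρ z
                    ∂(gibbs σ a θ u₀ N Φ) -
                  ∫ z, ρ z * Real.log (ρ z) ∂(gibbs σ a θ u₀ N Φ) ≤ δ * (N + 1)

/-- **The card's Transfer `C⁺` (ALMOST-INVARIANT DUALITY, finite `N`)** — the dual of the crux in `∀ρ ∃W` form:
in the crux's frame, for every bounded probability density `ρ` w.r.t. `G_N` there is a witness `W` in the cost ball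
`{|W| ≤ M, ∫exp(4|W|/h₀) dG_N ≤ e^{δ(N+1)}}` with `2∫(F − D_W)ρ dG_N − ∫ρ log ρ dG_N ≤ δ(N+1)`, i.e.
`2E_ρ F − H(ρ | G_N) ≤ δ(N+1) + 𝔄_{lag,M}(ρ)` with the Orlicz almost-invariance functional
`𝔄_{lag,M}(ρ) = (2/lag)·sup_{W ∈ 𝒲} ∫W d(Φ_lag#(ρG_N) − ρG_N)` (sup attained: `𝒲` weak*-compact). EQUIVALENT to the
crux (`CorrectorMinimax` ⇐, Gibbs/weak duality ⇒); proved below from stubs 3 + 4. Not itself a stub. -/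
def StatewiseDuality : Prop :=
  ∀ (a θ : ℝ) (u₀ : V3), 0 < a → 0 < θ → ∃ σ₀ : ℝ, 0 < σ₀ ∧ ∀ σ : ℝ, 0 < σ → σ < σ₀ →
    ∃ κ : ℝ, 0 < κ ∧ ∀ (φ : T3 → ℝ) (g : V3 → ℝ), Continuous φ → Continuous g →
      (∀ x, |φ x| ≤ 1) → (∀ v, |g v| ≤ κ) →
      (∀ (c₀ c₂ : ℝ) (b : V3),
        ∫ v, g v * (c₀ + inner ℝ b v + c₂ * ‖v‖ ^ 2) ∂(ProbabilityTheory.stdGaussian V3) = 0) →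
      ∀ δ : ℝ, 0 < δ → ∃ τ₀ : ℝ, 0 < τ₀ ∧ ∃ N₀ : ℕ, ∀ N : ℕ, N₀ ≤ N → ∀ Φ : Flow σ N,
        ∃ lag : ℝ, 0 < lag ∧ ∃ M : ℝ, 0 ≤ M ∧
          ∀ ρ : Phase N → ℝ, Measurable ρ → (∀ z, 0 ≤ ρ z) → (∃ C : ℝ, ∀ z, ρ z ≤ C) →
            ∫ z, ρ z ∂(gibbs σ a θ u₀ N Φ) = 1 →
            ∃ W : Phase N → ℝ, Measurable W ∧ (∀ z, |W z| ≤ M) ∧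
              ∫⁻ z, ENNReal.ofReal (Real.exp (4 * (τ₀ * ((N + 1 : ℕ) : ℝ) ^ (-(1 / 3 : ℝ)))⁻¹ * |W z|))
                  ∂(gibbs σ a θ u₀ N Φ) ≤ ENNReal.ofReal (Real.exp (δ * (N + 1))) ∧
              2 * ∫ z, (fluxObs θ u₀ φ g N z - lag⁻¹ * (W (Φ.flow lag z) - W z)) * ρ z
                  ∂(gibbs σ a θ u₀ N Φ) -
                ∫ z, ρ z * Real.log (ρ z) ∂(gibbs σ a θ u₀ N Φ) ≤ δ * (N + 1)

/-! ## Helpers -/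

/-- Measurability of the crux's one-body observable (continuity; `Config` over the torus is a Borel space). -/
theorem measurable_fluxObs {θ : ℝ} {u₀ : V3} {φ : T3 → ℝ} {g : V3 → ℝ} (hφ : Continuous φ)
    (hg : Continuous g) (N : ℕ) : Measurable (fluxObs θ u₀ φ g N) := by
  refine Continuous.measurable ?_
  unfold fluxObs
  fun_prop

/-- The crux's one-body observable is bounded by `(N+1)κ`. -/
theorem abs_fluxObs_le {θ κ : ℝ} {u₀ : V3} {φ : T3 → ℝ} {g : V3 → ℝ} (hφ1 : ∀ x, |φ x| ≤ 1)
    (hgκ : ∀ v, |g v| ≤ κ) (N : ℕ) (z : Phase N) : |fluxObs θ u₀ φ g N z| ≤ (N + 1) * κ := by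
  have hκ : 0 ≤ κ := (abs_nonneg _).trans (hgκ 0)
  calc |fluxObs θ u₀ φ g N z|
      ≤ ∑ i, |φ (z i).1 * g ((Real.sqrt θ)⁻¹ • ((z i).2 - u₀))| := Finset.abs_sum_le_sum_abs _ _
    _ ≤ ∑ _i : Fin (N + 1), κ := by
        refine Finset.sum_le_sum fun i _ => ?_
        rw [abs_mul]
        calc |φ (z i).1| * |g ((Real.sqrt θ)⁻¹ • ((z i).2 - u₀))|
            ≤ 1 * κ := mul_le_mul (hφ1 _) (hgκ _) (abs_nonneg _) zero_le_one
          _ = κ := one_mul κ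
    _ = (N + 1) * κ := by simp

/-! ## Weak duality: the Gibbs inequality for bounded densities -/

open Summit.AtomisticToContinuum.HydrodynamicLimit.Theorems.CorrectorPressureDecayNegative
  (integrable_exp_of_abs_le integrable_of_abs_le)

/-- `x ↦ x log x` is bounded on `[0, C]`. -/
theorem abs_mul_log_le {x C : ℝ} (hx : 0 ≤ x) (hxC : x ≤ C) : |x * Real.log x| ≤ 1 + C ^ 2 := by
  rcases le_or_gt x 1 with h1 | h1
  · rcases hx.eq_or_lt with hzero | hpos
    · rw [← hzero]
      simp only [zero_mul, abs_zero]
      positivity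
    · have h := Real.abs_log_mul_self_lt x hpos h1
      rw [mul_comm] at h
      nlinarith [sq_nonneg C]
  · have hlog : 0 ≤ Real.log x := Real.log_nonneg h1.le
    have hle : Real.log x ≤ x := (Real.log_le_sub_one_of_pos (by linarith)).trans (by linarith)
    rw [abs_of_nonneg (mul_nonneg hx hlog)]
    have h2 : x * Real.log x ≤ x * x := mul_le_mul_of_nonneg_left hle hx
    nlinarith

/-- **Gibbs inequality (weak duality).** For a probability measure `μ`, a bounded measurable `G` and a bounded
measurable probability density `ρ`: `∫ G ρ dμ − ∫ ρ log ρ dμ ≤ log ∫ e^G dμ` (pointwise Fenchel–Young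
`x·y ≤ x log x − x + e^y` at `y = G − log ∫e^G`, integrated). -/
theorem integral_mul_sub_entropy_le_log_integral_exp {X : Type*} [MeasurableSpace X] {μ : Measure X}
    [IsProbabilityMeasure μ] {G ρ : X → ℝ} (hGm : Measurable G) {CG : ℝ} (hG : ∀ x, |G x| ≤ CG)
    (hρm : Measurable ρ) (hρ0 : ∀ x, 0 ≤ ρ x) {Cρ : ℝ} (hρC : ∀ x, ρ x ≤ Cρ) (hρ1 : ∫ x, ρ x ∂μ = 1) :
    ∫ x, G x * ρ x ∂μ - ∫ x, ρ x * Real.log (ρ x) ∂μ ≤ Real.log (∫ x, Real.exp (G x) ∂μ) := by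
  set Z : ℝ := ∫ x, Real.exp (G x) ∂μ with hZ
  have hexp : Integrable (fun x => Real.exp (G x)) μ := integrable_exp_of_abs_le hGm hG
  have hZpos : 0 < Z := integral_exp_pos hexp
  -- pointwise Fenchel–Young with `y = G x − log Z`
  have hpt : ∀ x, ρ x * (G x - Real.log Z) ≤ ρ x * Real.log (ρ x) - ρ x + Real.exp (G x) / Z := by
    intro x
    have h := Literature.Probability.Divergences.klFun_fenchelYoung (hρ0 x) (G x - Real.log Z)
    rw [InformationTheory.klFun_apply, Real.exp_sub, Real.exp_log hZpos] at h
    linarith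
  -- integrability of everything in sight (all bounded on a probability space)
  have hρabs : ∀ x, |ρ x| ≤ Cρ := fun x => by rw [abs_of_nonneg (hρ0 x)]; exact hρC x
  have hρint : Integrable ρ μ := integrable_of_abs_le hρm hρabs
  have hGρ : Integrable (fun x => G x * ρ x) μ := by
    refine integrable_of_abs_le (hGm.mul hρm) (C := CG * Cρ) fun x => ?_
    rw [abs_mul]
    exact mul_le_mul (hG x) (hρabs x) (abs_nonneg _) ((abs_nonneg _).trans (hG x))
  have hent : Integrable (fun x => ρ x * Real.log (ρ x)) μ :=
    integrable_of_abs_le (hρm.mul (Real.measurable_log.comp hρm)) fun x => abs_mul_log_le (hρ0 x) (hρC x)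
  have hlhs : Integrable (fun x => ρ x * (G x - Real.log Z)) μ := by
    have h1 : (fun x => ρ x * (G x - Real.log Z)) = fun x => G x * ρ x - Real.log Z * ρ x := by
      funext x; ring
    rw [h1]
    exact hGρ.sub (hρint.const_mul (Real.log Z))
  have hsub : Integrable (fun x => ρ x * Real.log (ρ x) - ρ x) μ := hent.sub hρint
  have hdivi : Integrable (fun x => Real.exp (G x) / Z) μ := hexp.div_const Z
  have hrhs : Integrable (fun x => ρ x * Real.log (ρ x) - ρ x + Real.exp (G x) / Z) μ := hsub.add hdivi
  have hint := integral_mono hlhs hrhs hpt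
  -- evaluate both sides
  have hL : ∫ x, ρ x * (G x - Real.log Z) ∂μ = ∫ x, G x * ρ x ∂μ - Real.log Z := by
    have h1 : (fun x => ρ x * (G x - Real.log Z)) = fun x => G x * ρ x - Real.log Z * ρ x := by
      funext x; ring
    have h2 : Integrable (fun x => Real.log Z * ρ x) μ := hρint.const_mul (Real.log Z)
    rw [h1, integral_sub hGρ h2, integral_const_mul, hρ1, mul_one]
  have hR : ∫ x, (ρ x * Real.log (ρ x) - ρ x + Real.exp (G x) / Z) ∂μ = ∫ x, ρ x * Real.log (ρ x) ∂μ := by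
    rw [integral_add hsub hdivi, integral_sub hent hρint, integral_div, hρ1, ← hZ, div_self hZpos.ne']
    ring
  linarith [hint, hL, hR]

/-! ## The costume: `X ⇒ StatewiseDuality ⇒ AlmostInvariantRigidity` -/

/-- **Weak duality transfers the crux to the line's `C⁺`**: the crux's witness `(lag, W)` (one per `N, Φ`) serves every
state `ρ` simultaneously, its pay-off being bounded by the log-defect `≤ δ(N+1)`; `M :=` the witness's sup bound. -/
theorem statewiseDuality_of_correctorPressureDecay (hX : CorrectorPressureDecay) : StatewiseDuality := by
  intro a θ u₀ ha hθ
  obtain ⟨σ₀, hσ₀, Hσ⟩ := hX a θ u₀ ha hθ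
  refine ⟨σ₀, hσ₀, fun σ hσ hσlt => ?_⟩
  obtain ⟨hprob, κ, hκ, Hφ⟩ := Hσ σ hσ hσlt
  refine ⟨κ, hκ, fun φ g hφ hg hφ1 hgκ horth δ hδ => ?_⟩
  obtain ⟨τ₀, hτ₀, N₀, HN⟩ := Hφ φ g hφ hg hφ1 hgκ horth δ hδ
  refine ⟨τ₀, hτ₀, N₀, fun N hN Φ => ?_⟩
  obtain ⟨lag, hlag, W, hWm, ⟨CW, hCW⟩, hdef, hcost⟩ := HN N hN Φ
  haveI := hprob N Φ
  refine ⟨lag, hlag, max CW 0, le_max_right _ _, fun ρ hρm hρ0 hρC hρ1 => ?_⟩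
  obtain ⟨Cρ, hCρ⟩ := hρC
  refine ⟨W, hWm, fun z => (hCW z).trans (le_max_left _ _), hcost, ?_⟩
  -- the bounded measurable potential `G = 2(F − D_W)`
  set G : Phase N → ℝ := fun z => 2 * (fluxObs θ u₀ φ g N z - lag⁻¹ * (W (Φ.flow lag z) - W z)) with hGdef
  have hGm : Measurable G :=
    measurable_const.mul ((measurable_fluxObs hφ hg N).sub
      (measurable_const.mul ((hWm.comp (Φ.measurable_flow lag)).sub hWm)))
  have hGb : ∀ z, |G z| ≤ 2 * ((N + 1) * κ + lag⁻¹ * (CW + CW)) := by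
    intro z
    have h1 : |lag⁻¹ * (W (Φ.flow lag z) - W z)| ≤ lag⁻¹ * (CW + CW) := by
      rw [abs_mul, abs_of_pos (inv_pos.2 hlag)]
      exact mul_le_mul_of_nonneg_left ((abs_sub _ _).trans (add_le_add (hCW _) (hCW _))) (inv_pos.2 hlag).le
    have h2 : |fluxObs θ u₀ φ g N z - lag⁻¹ * (W (Φ.flow lag z) - W z)| ≤ (N + 1) * κ + lag⁻¹ * (CW + CW) :=
      (abs_sub _ _).trans (add_le_add (abs_fluxObs_le hφ1 hgκ N z) h1)
    calc |G z| = 2 * |fluxObs θ u₀ φ g N z - lag⁻¹ * (W (Φ.flow lag z) - W z)| := by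
          rw [hGdef]
          dsimp only
          rw [abs_mul, abs_two]
      _ ≤ 2 * ((N + 1) * κ + lag⁻¹ * (CW + CW)) := mul_le_mul_of_nonneg_left h2 zero_le_two
  -- from the `lintegral` defect bound of the crux to the Bochner one, then to its logarithm
  have hexpint : Integrable (fun z => Real.exp (G z)) (gibbs σ a θ u₀ N Φ) := integrable_exp_of_abs_le hGm hGb
  have hdefR : ∫ z, Real.exp (G z) ∂(gibbs σ a θ u₀ N Φ) ≤ Real.exp (δ * (N + 1)) := by
    have h1 : ENNReal.ofReal (∫ z, Real.exp (G z) ∂(gibbs σ a θ u₀ N Φ)) ≤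
        ENNReal.ofReal (Real.exp (δ * (N + 1))) := by
      rw [ofReal_integral_eq_lintegral_ofReal hexpint (ae_of_all _ fun z => (Real.exp_pos _).le)]
      exact hdef
    exact (ENNReal.ofReal_le_ofReal_iff (Real.exp_pos _).le).1 h1
  have hlog : Real.log (∫ z, Real.exp (G z) ∂(gibbs σ a θ u₀ N Φ)) ≤ δ * (N + 1) := by
    have hpos : 0 < ∫ z, Real.exp (G z) ∂(gibbs σ a θ u₀ N Φ) := integral_exp_pos hexpint
    rw [← Real.log_exp (δ * (N + 1))]
    exact Real.log_le_log hpos hdefR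
  have hmain := integral_mul_sub_entropy_le_log_integral_exp hGm hGb hρm hρ0 hCρ hρ1
  -- `∫ G ρ = 2 ∫ (F − D_W) ρ`
  have hGρ : ∫ z, G z * ρ z ∂(gibbs σ a θ u₀ N Φ) =
      2 * ∫ z, (fluxObs θ u₀ φ g N z - lag⁻¹ * (W (Φ.flow lag z) - W z)) * ρ z ∂(gibbs σ a θ u₀ N Φ) := by
    rw [← integral_const_mul]
    refine integral_congr_ae (ae_of_all _ fun z => ?_)
    rw [hGdef]
    dsimp only
    ring
  linarith [hmain, hGρ, hlog]

/-- The conditional rigidity follows from `C⁺` by dropping the anchor hypotheses (pure logic). -/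
theorem almostInvariantRigidity_of_statewiseDuality (h : StatewiseDuality) : AlmostInvariantRigidity := by
  intro _ a θ u₀ ha hθ
  obtain ⟨σ₀, hσ₀, Hσ⟩ := h a θ u₀ ha hθ
  refine ⟨σ₀, hσ₀, fun σ hσ hσlt => ?_⟩
  obtain ⟨κ, hκ, Hφ⟩ := Hσ σ hσ hσlt
  refine ⟨κ, hκ, fun φ g hφ hg hφ1 hgκ horth δ hδ => ?_⟩
  obtain ⟨τ₀, hτ₀, N₀, HN⟩ := Hφ φ g hφ hg hφ1 hgκ horth δ hδ
  refine ⟨τ₀, hτ₀, N₀, fun N hN Φ => ?_⟩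
  obtain ⟨lag, hlag, M, hM, R⟩ := HN N hN Φ
  exact ⟨lag, hlag, M, hM, fun ρ hρm hρ0 hρC hρ1 _ _ _ _ _ _ => R ρ hρm hρ0 hρC hρ1⟩

/-- **The line's hardest stub is implied by the crux** (weak duality): `CorrectorPressureDecay → AlmostInvariantRigidity`.
With the line's composition (`CorrectorMinimax → GibbsFlowInvariance → StatewiseDuality → CorrectorPressureDecay`, stubs
1–2 true) the stub is EQUIVALENT to the crux: a costume, no independent attack surface. -/
theorem almostInvariantRigidity_of_correctorPressureDecay (hX : CorrectorPressureDecay) : AlmostInvariantRigidity :=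
  almostInvariantRigidity_of_statewiseDuality (statewiseDuality_of_correctorPressureDecay hX)

end Summit.AtomisticToContinuum.HydrodynamicLimit.Cruxes.CorrectorPressureDecay.AlmostInvariantDualityCostume

end
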